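import Literature.Claims.NS.Kaliyeva2014
import Literature.Analysis.FluidPDE.AnomalousDissipationProofs
import Literature.Analysis.FunctionSpaces.TorusMollifierEstimates
import Literature.Analysis.FunctionSpaces.TorusTestFunction
import HarnessLib

/-!
# C180 `Kaliyeva2014` — kernel facts for the NS-claims sweep (D-0090), refuter-6 g6

Typed record: `Literature.Claims.NS.Kaliyeva2014` (typist-1 g7, p570327), K. Kaliyeva & A. Kaliyev,
*Existence and Uniqueness of the “Weak” and the “Strong” Solution of Navier–Stokes Equations*,
Proc. WCE 2014 vol. II, pp. 1288–1293: §III eqs. (17)–(20) p.1290–1291 — with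
`g := ∂ₜu − [u × rot u] − νΔu` (17) the paper writes the system (19) (rot g = rot f⃗ and
`∂g₁/∂x₁+∂g₂/∂x₂+∂g₃/∂x₃ = 0`) and solves it for `g = b(x,t)` from `f⃗` alone (20), i.e. the field
`∂ₜu − νΔu − [u × rot u]` of EVERY solution with force `f⃗` is one and the same `b`.

Kernel fact (sorry-free, standard axioms):

* `not_Step_20` — refutes `Literature.Claims.NS.Kaliyeva2014.Step_20` [refuted-substantive].
  Witness (steady Kolmogorov/Beltrami pair on `𝕋³`, `ν = 1`): `P(x) = (sin 2πx₂, 0, cos 2πx₂)`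
  (`PulsedShear.profile 1`), force `F = 4π² P` (smooth, `rot F ≠ 0`), and the two steady classical
  solutions `U₀ = P`, `U₁ = P + e₁` (pressure `0`, `(U·∇)U = 0`, `−ΔU = 4π²P = F`, `div U = 0`), each
  with its own smooth divergence-free datum. Both have force `F`, but
  `(∂ₜU − νΔU − lamb U)(0,0)` differs between them in the second coordinate by
  `∂₂(½|U₁|² − ½|U₀|²)(0) = ∂₂ P₁ (0) = 2π ≠ 0`; so no single `b` serves all solutions with force `F`.
  No cheap repair: `g = f⃗ − ∇(p + ½|u|²)` genuinely depends on the solution; (19)₃ `div g = 0` is an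
  added constraint, not a consequence of (14).

WHAT THIS IS NOT: not a claim about NS regularity or blow-up; not a claim about any author beyond the
typed locator.
-/

set_option linter.dupNamespace false

noncomputable section

open Real Set Function
open scoped ContDiff RealInnerProductSpace Laplacian
open Literature.Analysis.FunctionSpaces Literature.Analysis.FunctionSpaces.Torus
open Literature.Analysis.FluidPDE.PulsedShear
open Literature.Claims.NS.Kaliyeva2014

namespace Summit.NavierStokesRegularity.NavierStokesRegularity.Theorems.Kaliyeva2014

/-! ## The witness family -/

/-- The Beltrami shear profile `P(x) = (sin 2πx₂, 0, cos 2πx₂)` on `𝕋³`. [folklore] -/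
abbrev P : T3 → E3 := Literature.Analysis.FluidPDE.PulsedShear.profile 1

/-- The unit vector `e₁ = (1, 0, 0)`. [folklore] -/
def e0 : E3 := EuclideanSpace.single 0 1

/-- The steady velocity `U_c = P + c e₁`. [folklore] -/
def U (c : ℝ) : T3 → E3 := P + fun _ => c • e0

/-- The common force `F = 4π²ν P`. [folklore] -/
def F (ν : ℝ) : ℝ → T3 → E3 := fun _ => (4 * π ^ 2 * ν) • P

/-- The zero pressure. [folklore] -/
def p0 : ℝ → T3 → ℝ := fun _ _ => 0

/-- `e₀` has vanishing second component. [folklore] -/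
@[simp] theorem e0_apply_one : e0 1 = 0 := by simp [e0]

/-- `e₀` has first component `1`. [folklore] -/
@[simp] theorem e0_apply_zero : e0 0 = 1 := by simp [e0]

/-- Unfolding the witness velocity `U_c = P + c e₀`. [folklore] -/
theorem U_apply (c : ℝ) (x : T3) : U c x = P x + c • e0 := rfl

/-- `U_c` is smooth. [folklore] -/
theorem isSmooth_U (c : ℝ) : IsSmooth (U c) := (isSmooth_profile 1).add (isSmooth_const _)

/-- `U_c` is `C¹`. [folklore] -/
theorem isContDiff_U (c : ℝ) : IsContDiff 1 (U c) := (isSmooth_U c).isContDiff (by simp)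

/-- Partial derivatives of constants vanish. [folklore] -/
theorem partialDeriv_const' {G : Type*} [NormedAddCommGroup G] [NormedSpace ℝ G] (i : Fin 3) (v : G)
    (x : T3) : partialDeriv i (fun _ : T3 => v) x = 0 := by
  simp [partialDeriv, Torus.lineDeriv]

/-- `∂ᵢ U_c = ∂ᵢ P`. [folklore] -/
theorem partialDeriv_U (c : ℝ) (i : Fin 3) (x : T3) : partialDeriv i (U c) x = partialDeriv i P x := by
  rw [U, partialDeriv_add (isContDiff_profile 1) (isContDiff_const _), Pi.add_apply, partialDeriv_const',
    add_zero]

/-- `(U_c)₂ = 0`. [folklore] -/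
theorem U_apply_one (c : ℝ) (x : T3) : U c x 1 = 0 := by
  simp [U_apply, profile_apply_one]

/-- Shear flows have no self-advection: `(U_c·∇)U_c = 0`. [folklore] -/
theorem convect_U (c : ℝ) (x : T3) : Torus.convect (U c) (U c) x = 0 := by
  unfold Torus.convect
  rw [fderiv_apply_eq_sum_partialDeriv (isContDiff_U c), Fin.sum_univ_three, partialDeriv_U, partialDeriv_U,
    partialDeriv_U, partialDeriv_profile_of_ne_one 1 (by decide : (0 : Fin 3) ≠ 1),
    partialDeriv_profile_of_ne_one 1 (by decide : (2 : Fin 3) ≠ 1), U_apply_one]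
  simp

/-- `Δ U_c = −4π² P`. [folklore] -/
theorem laplacian_U (c : ℝ) (x : T3) : Torus.laplacian (U c) x = -(4 * π ^ 2) • P x := by
  rw [U, laplacian_add_apply (isSmooth_profile 1) (isSmooth_const _), laplacian_profile]
  have h0 : Torus.laplacian (fun _ : T3 => c • e0) x = 0 := by
    unfold Torus.laplacian liftAt
    simp
  rw [h0, add_zero]
  simp

/-- `div U_c = 0`. [folklore] -/
theorem isDivFree_U (c : ℝ) : IsDivFree (U c) := by
  intro x
  have hP := isDivFree_profile 1 x
  unfold Torus.divergence at hP ⊢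
  rw [← hP]
  refine Finset.sum_congr rfl fun i _ => ?_
  rw [partialDeriv_apply_coord (isContDiff_U c), partialDeriv_apply_coord (isContDiff_profile 1),
    partialDeriv_U]

/-- `∇ 0 = 0`. [folklore] -/
theorem gradient_p0 (t : ℝ) (x : T3) : Torus.gradient (p0 t) x = 0 := by
  unfold p0 Torus.gradient liftAt
  simp [_root_.gradient]

/-- A steady field has zero time derivative. [folklore] -/
theorem timeDerivWithin_steady (S : Set ℝ) (w : T3 → E3) (t : ℝ) (x : T3) :
    Torus.timeDerivWithin S (fun _ => w) t x = 0 := by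
  simp [Torus.timeDerivWithin]

/-- A steady smooth field is jointly smooth in space–time. [folklore] -/
theorem isSmoothSpaceTimeOn_steady {w : T3 → E3} (hw : IsSmooth w) (S : Set ℝ) :
    IsSmoothSpaceTimeOn S (fun _ => w) := by
  unfold IsSmoothSpaceTimeOn
  have h : stLift (fun _ : ℝ => w) = fun p : ℝ × EuclideanSpace ℝ (Fin 3) => lift w p.2 := rfl
  rw [h]
  exact (hw.comp contDiff_snd).contDiffOn

/-- The zero pressure is jointly smooth. [folklore] -/
theorem isSmoothSpaceTimeOn_p0 (S : Set ℝ) : IsSmoothSpaceTimeOn S p0 := by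
  change ContDiffOn ℝ ∞ (fun _ => (0 : ℝ)) _
  exact contDiffOn_const

/-- `F` is smooth in space. [folklore] -/
theorem isSmooth_F_slice (ν : ℝ) : IsSmooth ((4 * π ^ 2 * ν) • P) := by
  change ContDiff ℝ ∞ (fun y => ((4 * π ^ 2 * ν) • P) (proj y))
  simp only [Pi.smul_apply]
  have hc : ContDiff ℝ ∞ (fun _ : EuclideanSpace ℝ (Fin 3) => (4 * π ^ 2 * ν : ℝ)) := contDiff_const
  have hP : ContDiff ℝ ∞ (fun y : EuclideanSpace ℝ (Fin 3) => P (proj y)) := isSmooth_profile 1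
  exact hc.smul hP

/-- `F` is an admissible force (jointly smooth on `[0,∞) × 𝕋³`). [folklore] -/
theorem isForce_F (ν : ℝ) : IsForce (F ν) := isSmoothSpaceTimeOn_steady (isSmooth_F_slice ν) _

/-- `U_c` is an admissible datum. [folklore] -/
theorem isDatum_U (c : ℝ) : IsDatum (U c) := ⟨isSmooth_U c, isDivFree_U c⟩

/-- **`(U_c, 0)` is a classical Navier–Stokes solution on `[0,∞) × 𝕋³` with force `F = 4π²ν P` and
datum `U_c`**, for every `c` and every `ν`. [folklore] -/
theorem isSolution_U (ν c : ℝ) : IsSolution ν (F ν) (U c) (fun _ => U c) p0 := by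
  refine ⟨⟨isSmoothSpaceTimeOn_steady (isSmooth_U c) _, isSmoothSpaceTimeOn_p0 _, ?_, fun _ _ => isDivFree_U c⟩,
    rfl⟩
  intro t _ x
  rw [timeDerivWithin_steady, convect_U, laplacian_U, gradient_p0, zero_add, sub_zero, smul_smul]
  show (0 : E3) = (ν * -(4 * π ^ 2)) • P x + (4 * π ^ 2 * ν) • P x
  rw [← add_smul]
  have h : ν * -(4 * π ^ 2) + 4 * π ^ 2 * ν = 0 := by ring
  rw [h, zero_smul]

/-! ## The distinguishing quantities -/

/-- `e_k(0) = 1`. [folklore] -/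
theorem mFourier_zero' (k : Fin 3 → ℤ) : UnitAddTorus.mFourier k (0 : T3) = 1 := by
  simp [UnitAddTorus.mFourier]

/-- `(∂₂ P)(0) · e₁ = 2π`. [folklore] -/
theorem partialDeriv_one_P_zero : partialDeriv 1 P 0 0 = 2 * π := by
  rw [partialDeriv_profile, mFourier_zero']
  simp [EuclideanSpace.realPart_apply]

/-- **`rot F ≠ 0`** (`ν ≠ 0`): `(∂₂F₁ − ∂₁F₂)(0) = 4π²ν · 2π`. [folklore] -/
theorem rotNonzero_F {ν : ℝ} (hν : ν ≠ 0) : RotNonzero (F ν) := by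
  refine ⟨0, le_rfl, 0, 1, 0, ?_⟩
  unfold rotEntry F
  rw [partialDeriv_const_smul (isContDiff_profile 1), partialDeriv_const_smul (isContDiff_profile 1),
    Pi.smul_apply, Pi.smul_apply, partialDeriv_profile_of_ne_one 1 (by decide : (0 : Fin 3) ≠ 1), smul_zero,
    PiLp.smul_apply, partialDeriv_one_P_zero, PiLp.zero_apply, sub_zero, smul_eq_mul]
  have : 0 < 4 * π ^ 2 * (2 * π) := by positivity
  intro h
  rcases mul_eq_zero.mp h with h1 | h2
  · rcases mul_eq_zero.mp h1 with h3 | h4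
    · have : (4 : ℝ) * π ^ 2 ≠ 0 := by positivity
      exact this h3
    · exact hν h4
  · have : (2 : ℝ) * π ≠ 0 := by positivity
    exact this h2

/-- The kinetic-energy density of `U_c`. [folklore] -/
def θ (c : ℝ) : T3 → ℝ := fun y => ‖U c y‖ ^ 2 / 2

/-- `θ_c` is smooth. [folklore] -/
theorem isSmooth_θ (c : ℝ) : IsSmooth (θ c) := by
  change ContDiff ℝ ∞ (fun z => ‖lift (U c) z‖ ^ 2 / 2)
  exact (isSmooth_U c).norm_sq.div_const 2

/-- The first coordinate of the profile, `P₁ = sin 2πx₂`, is `C¹`. [folklore] -/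
theorem isContDiff_P0 : IsContDiff 1 (fun y => P y 0) :=
  (EuclideanSpace.proj (0 : Fin 3) : E3 →L[ℝ] ℝ).contDiff.comp (isContDiff_profile 1)

/-- `δ := P₁ + ½ = θ₁ − θ₀`. [folklore] -/
def δ : T3 → ℝ := (fun y => P y 0) + fun _ => (1 / 2 : ℝ)

/-- `δ` is `C¹`. [folklore] -/
theorem isContDiff_δ : IsContDiff 1 δ := isContDiff_P0.add (isContDiff_const _)

/-- `θ₁ = θ₀ + δ`. [folklore] -/
theorem θ_one_eq : θ 1 = θ 0 + δ := by
  funext y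
  simp only [θ, δ, U_apply, one_smul, zero_smul, add_zero, Pi.add_apply]
  rw [norm_add_sq_real]
  have h1 : ⟪P y, e0⟫ = P y 0 := by
    rw [e0, EuclideanSpace.inner_single_right]
    simp
  have h2 : ‖e0‖ = 1 := by simp [e0]
  rw [h1, h2]
  ring

/-- `∂₂ δ (0) = 2π`. [folklore] -/
theorem partialDeriv_one_δ_zero : partialDeriv 1 δ 0 = 2 * π := by
  rw [δ, partialDeriv_add isContDiff_P0 (isContDiff_const _), Pi.add_apply, partialDeriv_const', add_zero,
    partialDeriv_apply_coord (isContDiff_profile 1), partialDeriv_one_P_zero]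

/-- `lamb U_c = ∇θ_c` (no self-advection). [folklore] -/
theorem lamb_U (c : ℝ) (x : T3) : lamb (U c) x = Torus.gradient (θ c) x := by
  rw [lamb, convect_U, sub_zero]
  rfl

/-- **The two solutions have different `g`-fields**: `(lamb U₁ − lamb U₀)(0) · e₂ = 2π`. [folklore] -/
theorem lamb_U_one_sub_lamb_U_zero : lamb (U 1) 0 1 - lamb (U 0) 0 1 = 2 * π := by
  rw [lamb_U, lamb_U, gradient_apply ((isSmooth_θ 1).isContDiff (by simp)),
    gradient_apply ((isSmooth_θ 0).isContDiff (by simp)), θ_one_eq,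
    partialDeriv_add ((isSmooth_θ 0).isContDiff (by simp)) isContDiff_δ, Pi.add_apply,
    partialDeriv_one_δ_zero]
  ring

/-! ## The kernel fact -/

/-- **§III (19)–(20) p.1290–1291 is false (C180): the field `g = ∂ₜu − νΔu − [u × rot u]` is NOT
determined by the force.** With `ν = 1` and the force `F = 4π² P` (`rot F ≠ 0`), the steady classical
solutions `U₀ = P` and `U₁ = P + e₁` (pressure `0`) give `g`-fields differing by `2π e₂` at
`(t,x) = (0,0)`, so no `b` with `g = b` for all solutions exists. Refutes
`Literature.Claims.NS.Kaliyeva2014.Step_20` [refuted-substantive: `g = f⃗ − ∇(p + ½|u|²)` depends on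
the solution; the printed (19)₃/(20) delete the Bernoulli pressure]. [folklore] -/
theorem not_Step_20 : ¬ Literature.Claims.NS.Kaliyeva2014.Step_20 := by
  intro h
  obtain ⟨b, -, hb⟩ := h 1 one_pos (F 1) (isForce_F 1) (rotNonzero_F one_ne_zero)
  have h0 := hb (U 0) (fun _ => U 0) p0 (isSolution_U 1 0) 0 le_rfl 0
  have h1 := hb (U 1) (fun _ => U 1) p0 (isSolution_U 1 1) 0 le_rfl 0
  simp only [timeDerivWithin_steady, laplacian_U] at h0 h1
  have h01 := congrArg (fun v : E3 => v 1) (h0.trans h1.symm)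
  simp only [PiLp.sub_apply] at h01
  have hd := lamb_U_one_sub_lamb_U_zero
  linarith [pi_pos]

end Summit.NavierStokesRegularity.NavierStokesRegularity.Theorems.Kaliyeva2014
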